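import Summits.QuantumFields.YangMills.Theorems.UnitScaleTiltProp7NestedMeanParallelLiftDiagGauge
import HarnessLib

/-!
# Route `UnitScaleTilt`, crux K1 child «MinimiserStabilityRegPr» (stmt-QuantumFields-19200), stub `stub_existenceMinimalOrbit` (EX), line «SYM-CENTRE»
# (★★OWNER RULING g28-№7 cure (ii-a); px20 g2 LOCATE #56 (V1) trichotomy) — **THE CASE SPLIT OF THE `hSymCentre` SUPPLIER: either every `V♭`-parallel section
# is a scalar (the irreducible case, ✓`hSymCentre_of_irreducible`) or some coarse gauge makes every bond variable of `V` commute with `σ₃` (the reducible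
# case, ✓`exists_gauge_commute_sigma3_of_parallel`)**

Cell `ym3-torus`, width seat `ym3-torus-px6` (gen 3).  THEOREMS ONLY (0 `def`, 0 `sorry`).  `--supports stmt-QuantumFields-19200 --as helper`, count-neutral.
YM₃ on T³ is a ladder rung (R3), not the Clay problem; nothing here claims the stub, the crux, d = 4 or the mass gap.

THE POINT.  ✓`exists_gauge_commute_sigma3_of_parallel` (R1-DIAG-GAUGE) wants a HERMITIAN TRACELESS non-zero parallel section, whereas the negation of the
irreducible branch `hIrr` («every parallel section is `z • 1`») only gives SOME non-scalar parallel section `c : T_{(n)} → M₂(ℂ)`.  Because `V♭` is unitary, the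
parallel sections form a ⋆-closed subspace containing the scalars: `c⋆` is parallel (§1), the trace of a parallel section is transported hence constant
(✓`const_of_shift_eq`), so the Hermitian traceless parts `a₀ = ½(c + c⋆) − ½tr·1`, `b₀ = (2i)⁻¹(c − c⋆) − …` are parallel, and `c = a₀ + i b₀ + (½tr c)·1`; if
both vanished identically `c` would be scalar.  Hence the dichotomy (§2) and, with R1-DIAG-GAUGE, the supplier's split (§3).
* §1 `coe_inv_unitsField_toUField` (`(V♭(e))⁻¹ = V♭(e)⋆`), `parallel_star`, `parallel_add`, `parallel_smul`, `parallel_sub_smul_one`, `trace_parallel_const`.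
* §2 ★★`exists_hermitian_traceless_parallel_of_not_onlyScalar`.
* §3 ★★★`onlyScalar_or_exists_gauge_commute_sigma3` — for every `SU(2)` configuration `V` on a torus lattice: EITHER every `V♭`-parallel section is scalar OR
  `∃ g, ∀ e, Commute ((g • V)(e) : M₂(ℂ)) σ₃`.
HONEST SCOPE.  Linear algebra; no estimate; no stub ∕ crux statement is advanced.

References: T. Bałaban, CMP 99 (1985) 389–434 [Balaban1985BackgroundPropagators] ((3.19)–(3.21) pp.393–394); CMP 98 (1985) 17–51 [Balaban1985Averaging] ((8)–(11) p.19).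
-/

set_option autoImplicit false

noncomputable section

open scoped BigOperators Matrix.Norms.L2Operator Matrix

namespace Summit.QuantumFields.YangMills.Theorems.Prop7NestedMeanParallelLiftDiagGauge

open Literature.MathematicalPhysics.QuantumFieldTheory.Balaban1983to89
open T4Continuum BlockAveraging
open B10Eq27TorusAxialLog (unitsField toUField val_unitsField val_suIncl)
open B9AdOrthogonal (σ₃)
open Summit.QuantumFields.YangMills.BalabanUVNodes.N12FlatFibreNullSpace (const_of_shift_eq)
open B5Positivity172Lattice (TT ofT)

section Split

variable {P : Params} (V : GaugeField P 0 (Matrix.specialUnitaryGroup (Fin 2) ℂ))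

/-! ## §1 Parallel sections form a ⋆-closed subspace containing the scalars -/

/-- The inverse of the unit `V♭(e)` is its adjoint (`V(e)` is unitary). [cite: Balaban1985Averaging, (19) p.21] -/
theorem coe_inv_unitsField_toUField (e : PBond P 0) :
    (((unitsField (toUField V) e)⁻¹ : (Matrix (Fin 2) (Fin 2) ℂ)ˣ) : Matrix (Fin 2) (Fin 2) ℂ) =
      star ((V e : Matrix.specialUnitaryGroup (Fin 2) ℂ) : Matrix (Fin 2) (Fin 2) ℂ) := by
  apply Units.inv_eq_of_mul_eq_one_right
  rw [coe_unitsField_toUField]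
  exact Matrix.mem_unitaryGroup_iff.1 (V e).2.1

/-- A parallel section read with the adjoint: `c(e₋) = V(e)·c(e₊)·V(e)⋆`. [cite: Balaban1985BackgroundPropagators, (3.21) p.394] -/
theorem parallel_iff_star (c : Site P 0 → Matrix (Fin 2) (Fin 2) ℂ) (e : PBond P 0) :
    c e.src = ((unitsField (toUField V) e : (Matrix (Fin 2) (Fin 2) ℂ)ˣ) : Matrix (Fin 2) (Fin 2) ℂ) * c e.tgt *
        (((unitsField (toUField V) e)⁻¹ : (Matrix (Fin 2) (Fin 2) ℂ)ˣ) : Matrix (Fin 2) (Fin 2) ℂ) ↔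
      c e.src = ((V e : Matrix.specialUnitaryGroup (Fin 2) ℂ) : Matrix (Fin 2) (Fin 2) ℂ) * c e.tgt *
        star ((V e : Matrix.specialUnitaryGroup (Fin 2) ℂ) : Matrix (Fin 2) (Fin 2) ℂ) := by
  rw [coe_inv_unitsField_toUField, coe_unitsField_toUField]

/-- `c` parallel ⇒ `c⋆` parallel. [cite: Balaban1985BackgroundPropagators, (3.21) p.394] -/
theorem parallel_star {c : Site P 0 → Matrix (Fin 2) (Fin 2) ℂ}
    (hc : ∀ e : PBond P 0, c e.src = ((unitsField (toUField V) e : (Matrix (Fin 2) (Fin 2) ℂ)ˣ) : Matrix (Fin 2) (Fin 2) ℂ) * c e.tgt *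
      (((unitsField (toUField V) e)⁻¹ : (Matrix (Fin 2) (Fin 2) ℂ)ˣ) : Matrix (Fin 2) (Fin 2) ℂ)) :
    ∀ e : PBond P 0, star (c e.src) = ((unitsField (toUField V) e : (Matrix (Fin 2) (Fin 2) ℂ)ˣ) : Matrix (Fin 2) (Fin 2) ℂ) * star (c e.tgt) *
      (((unitsField (toUField V) e)⁻¹ : (Matrix (Fin 2) (Fin 2) ℂ)ˣ) : Matrix (Fin 2) (Fin 2) ℂ) := by
  intro e
  rw [parallel_iff_star V (fun y => star (c y))]
  rw [(parallel_iff_star V c e).1 (hc e), star_mul, star_mul, star_star, mul_assoc]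

/-- Sums of parallel sections are parallel. [cite: Balaban1985BackgroundPropagators, (3.21) p.394] -/
theorem parallel_add {c d : Site P 0 → Matrix (Fin 2) (Fin 2) ℂ}
    (hc : ∀ e : PBond P 0, c e.src = ((unitsField (toUField V) e : (Matrix (Fin 2) (Fin 2) ℂ)ˣ) : Matrix (Fin 2) (Fin 2) ℂ) * c e.tgt *
      (((unitsField (toUField V) e)⁻¹ : (Matrix (Fin 2) (Fin 2) ℂ)ˣ) : Matrix (Fin 2) (Fin 2) ℂ))
    (hd : ∀ e : PBond P 0, d e.src = ((unitsField (toUField V) e : (Matrix (Fin 2) (Fin 2) ℂ)ˣ) : Matrix (Fin 2) (Fin 2) ℂ) * d e.tgt *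
      (((unitsField (toUField V) e)⁻¹ : (Matrix (Fin 2) (Fin 2) ℂ)ˣ) : Matrix (Fin 2) (Fin 2) ℂ)) :
    ∀ e : PBond P 0, (c e.src + d e.src) = ((unitsField (toUField V) e : (Matrix (Fin 2) (Fin 2) ℂ)ˣ) : Matrix (Fin 2) (Fin 2) ℂ) * (c e.tgt + d e.tgt) *
      (((unitsField (toUField V) e)⁻¹ : (Matrix (Fin 2) (Fin 2) ℂ)ˣ) : Matrix (Fin 2) (Fin 2) ℂ) := by
  intro e
  rw [hc e, hd e, mul_add, add_mul]

/-- Scalar multiples of parallel sections are parallel. [cite: Balaban1985BackgroundPropagators, (3.21) p.394] -/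
theorem parallel_smul (z : ℂ) {c : Site P 0 → Matrix (Fin 2) (Fin 2) ℂ}
    (hc : ∀ e : PBond P 0, c e.src = ((unitsField (toUField V) e : (Matrix (Fin 2) (Fin 2) ℂ)ˣ) : Matrix (Fin 2) (Fin 2) ℂ) * c e.tgt *
      (((unitsField (toUField V) e)⁻¹ : (Matrix (Fin 2) (Fin 2) ℂ)ˣ) : Matrix (Fin 2) (Fin 2) ℂ)) :
    ∀ e : PBond P 0, z • c e.src = ((unitsField (toUField V) e : (Matrix (Fin 2) (Fin 2) ℂ)ˣ) : Matrix (Fin 2) (Fin 2) ℂ) * (z • c e.tgt) *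
      (((unitsField (toUField V) e)⁻¹ : (Matrix (Fin 2) (Fin 2) ℂ)ˣ) : Matrix (Fin 2) (Fin 2) ℂ) := by
  intro e
  rw [hc e, Matrix.mul_smul, Matrix.smul_mul]

/-- Scalars are parallel, so `c − z·1` is parallel with `c`. [cite: Balaban1985BackgroundPropagators, (3.21) p.394] -/
theorem parallel_sub_smul_one (z : ℂ) {c : Site P 0 → Matrix (Fin 2) (Fin 2) ℂ}
    (hc : ∀ e : PBond P 0, c e.src = ((unitsField (toUField V) e : (Matrix (Fin 2) (Fin 2) ℂ)ˣ) : Matrix (Fin 2) (Fin 2) ℂ) * c e.tgt *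
      (((unitsField (toUField V) e)⁻¹ : (Matrix (Fin 2) (Fin 2) ℂ)ˣ) : Matrix (Fin 2) (Fin 2) ℂ)) :
    ∀ e : PBond P 0, (c e.src - z • (1 : Matrix (Fin 2) (Fin 2) ℂ)) =
      ((unitsField (toUField V) e : (Matrix (Fin 2) (Fin 2) ℂ)ˣ) : Matrix (Fin 2) (Fin 2) ℂ) * (c e.tgt - z • (1 : Matrix (Fin 2) (Fin 2) ℂ)) *
      (((unitsField (toUField V) e)⁻¹ : (Matrix (Fin 2) (Fin 2) ℂ)ˣ) : Matrix (Fin 2) (Fin 2) ℂ) := by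
  intro e
  rw [hc e, mul_sub, sub_mul, Matrix.mul_smul, Matrix.smul_mul, mul_one, Units.mul_inv]

/-- The trace of a parallel section is constant on the (connected) torus. [cite: Balaban1985BackgroundPropagators, (3.21) p.394] -/
theorem trace_parallel_const {c : Site P 0 → Matrix (Fin 2) (Fin 2) ℂ}
    (hc : ∀ e : PBond P 0, c e.src = ((unitsField (toUField V) e : (Matrix (Fin 2) (Fin 2) ℂ)ˣ) : Matrix (Fin 2) (Fin 2) ℂ) * c e.tgt *
      (((unitsField (toUField V) e)⁻¹ : (Matrix (Fin 2) (Fin 2) ℂ)ˣ) : Matrix (Fin 2) (Fin 2) ℂ)) (y : Site P 0) :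
    (c y).trace = (c (ofT (0 : TT P 0))).trace :=
  const_of_shift_eq (fun x => (c x).trace) (fun x μ => by
    have h := congrArg Matrix.trace (hc ⟨x, μ⟩)
    rw [Matrix.trace_units_conj] at h
    exact h.symm) y

/-! ## §2 A non-scalar parallel section has a non-zero Hermitian traceless parallel part -/

/-- `½(m + m⋆)` is Hermitian. [folklore] -/
theorem isHermitian_half_add_star (m : Matrix (Fin 2) (Fin 2) ℂ) : ((2 : ℂ)⁻¹ • (m + star m)).IsHermitian := by
  show star ((2 : ℂ)⁻¹ • (m + star m)) = (2 : ℂ)⁻¹ • (m + star m)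
  rw [star_smul, star_add, star_star, add_comm (star m) m]
  congr 1
  simp

/-- `(2i)⁻¹(m − m⋆)` is Hermitian. [folklore] -/
theorem isHermitian_halfI_sub_star (m : Matrix (Fin 2) (Fin 2) ℂ) : (((2 : ℂ)⁻¹ * -Complex.I) • (m - star m)).IsHermitian := by
  show star (((2 : ℂ)⁻¹ * -Complex.I) • (m - star m)) = ((2 : ℂ)⁻¹ * -Complex.I) • (m - star m)
  rw [star_smul, star_sub, star_star]
  have h2 : star ((2 : ℂ)⁻¹ * -Complex.I) = -((2 : ℂ)⁻¹ * -Complex.I) := by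
    apply Complex.ext <;> simp
  rw [h2, neg_smul, ← smul_neg, neg_sub]

/-- The trace of a Hermitian matrix is self-adjoint. [folklore] -/
theorem star_trace_of_isHermitian {m : Matrix (Fin 2) (Fin 2) ℂ} (hm : m.IsHermitian) : star m.trace = m.trace := by
  rw [← Matrix.trace_conjTranspose, hm.eq]

/-- Subtracting a real multiple of `1` keeps Hermitian. [folklore] -/
theorem isHermitian_sub_smul_one {m : Matrix (Fin 2) (Fin 2) ℂ} (hm : m.IsHermitian) {t : ℂ} (ht : star t = t) :
    (m - t • (1 : Matrix (Fin 2) (Fin 2) ℂ)).IsHermitian := by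
  show star (m - t • (1 : Matrix (Fin 2) (Fin 2) ℂ)) = m - t • 1
  rw [star_sub, star_smul, star_one, ht]
  exact congrArg (· - t • 1) hm.eq

/-- `m = ½(m + m⋆) + i·(2i)⁻¹(m − m⋆)`. [folklore] -/
theorem decomp_herm (m : Matrix (Fin 2) (Fin 2) ℂ) :
    m = (2 : ℂ)⁻¹ • (m + star m) + Complex.I • (((2 : ℂ)⁻¹ * -Complex.I) • (m - star m)) := by
  rw [smul_smul]
  have hI : Complex.I * ((2 : ℂ)⁻¹ * -Complex.I) = (2 : ℂ)⁻¹ := by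
    rw [mul_comm, mul_assoc, neg_mul, Complex.I_mul_I, neg_neg, mul_one]
  rw [hI, ← smul_add]
  have : m + star m + (m - star m) = (2 : ℂ) • m := by rw [two_smul]; abel
  rw [this, smul_smul, inv_mul_cancel₀ two_ne_zero, one_smul]

/-- Removing half the trace makes a `2 × 2` matrix traceless. [folklore] -/
theorem trace_sub_half_trace_smul_one (m : Matrix (Fin 2) (Fin 2) ℂ) {t : ℂ} (hm : m.trace = t) :
    (m - ((2 : ℂ)⁻¹ * t) • (1 : Matrix (Fin 2) (Fin 2) ℂ)).trace = 0 := by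
  rw [Matrix.trace_sub, Matrix.trace_smul, Matrix.trace_one, Fintype.card_fin, hm, smul_eq_mul]
  push_cast; ring

/-- ★★ **NON-SCALAR PARALLEL ⇒ HERMITIAN TRACELESS NON-ZERO PARALLEL.**  If NOT every `V♭`-parallel section is a scalar, then there is a `V♭`-parallel section
`h` with `h(y)` Hermitian and traceless for all `y` and `h ≠ 0` somewhere (one of the Hermitian traceless parts `a₀`, `b₀` of a non-scalar parallel `c`; if both
vanished, `c = (½ tr c)·1` with constant trace would be scalar). [cite: Balaban1985BackgroundPropagators, (3.21) p.394] -/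
theorem exists_hermitian_traceless_parallel_of_not_onlyScalar
    (hnot : ¬ ∀ c : Site P 0 → Matrix (Fin 2) (Fin 2) ℂ,
      (∀ e : PBond P 0, c e.src = ((unitsField (toUField V) e : (Matrix (Fin 2) (Fin 2) ℂ)ˣ) : Matrix (Fin 2) (Fin 2) ℂ) * c e.tgt *
        (((unitsField (toUField V) e)⁻¹ : (Matrix (Fin 2) (Fin 2) ℂ)ˣ) : Matrix (Fin 2) (Fin 2) ℂ)) →
      ∃ z : ℂ, ∀ y, c y = z • (1 : Matrix (Fin 2) (Fin 2) ℂ)) :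
    ∃ h : Site P 0 → Matrix (Fin 2) (Fin 2) ℂ, (∀ y, (h y).IsHermitian) ∧ (∀ y, (h y).trace = 0) ∧
      (∀ e : PBond P 0, h e.src = ((unitsField (toUField V) e : (Matrix (Fin 2) (Fin 2) ℂ)ˣ) : Matrix (Fin 2) (Fin 2) ℂ) * h e.tgt *
        (((unitsField (toUField V) e)⁻¹ : (Matrix (Fin 2) (Fin 2) ℂ)ˣ) : Matrix (Fin 2) (Fin 2) ℂ)) ∧
      ∃ y, h y ≠ 0 := by
  classical
  obtain ⟨c, hc'⟩ := not_forall.1 hnot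
  obtain ⟨hc, hns⟩ := Classical.not_imp.1 hc'
  have hcs := parallel_star V hc
  -- the two Hermitian parts are parallel
  have hpa : ∀ e : PBond P 0, (2 : ℂ)⁻¹ • (c e.src + star (c e.src)) =
      ((unitsField (toUField V) e : (Matrix (Fin 2) (Fin 2) ℂ)ˣ) : Matrix (Fin 2) (Fin 2) ℂ) * ((2 : ℂ)⁻¹ • (c e.tgt + star (c e.tgt))) *
        (((unitsField (toUField V) e)⁻¹ : (Matrix (Fin 2) (Fin 2) ℂ)ˣ) : Matrix (Fin 2) (Fin 2) ℂ) := fun e =>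
    parallel_smul V (2 : ℂ)⁻¹ (c := fun y => c y + star (c y)) (parallel_add V (c := c) (d := fun y => star (c y)) hc hcs) e
  have hpb : ∀ e : PBond P 0, ((2 : ℂ)⁻¹ * -Complex.I) • (c e.src - star (c e.src)) =
      ((unitsField (toUField V) e : (Matrix (Fin 2) (Fin 2) ℂ)ˣ) : Matrix (Fin 2) (Fin 2) ℂ) * (((2 : ℂ)⁻¹ * -Complex.I) • (c e.tgt - star (c e.tgt))) *
        (((unitsField (toUField V) e)⁻¹ : (Matrix (Fin 2) (Fin 2) ℂ)ˣ) : Matrix (Fin 2) (Fin 2) ℂ) := by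
    refine parallel_smul V _ (c := fun y => c y - star (c y)) fun e => ?_
    show c e.src - star (c e.src) = _ * (c e.tgt - star (c e.tgt)) * _
    rw [hcs e, hc e, mul_sub, sub_mul]
  -- their constant traces and the traceless corrections
  set ta : ℂ := ((2 : ℂ)⁻¹ • (c (ofT (0 : TT P 0)) + star (c (ofT (0 : TT P 0))))).trace with hta
  set tb : ℂ := (((2 : ℂ)⁻¹ * -Complex.I) • (c (ofT (0 : TT P 0)) - star (c (ofT (0 : TT P 0))))).trace with htb
  have htra : ∀ y, ((2 : ℂ)⁻¹ • (c y + star (c y))).trace = ta :=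
    trace_parallel_const V (c := fun y => (2 : ℂ)⁻¹ • (c y + star (c y))) hpa
  have htrb : ∀ y, (((2 : ℂ)⁻¹ * -Complex.I) • (c y - star (c y))).trace = tb :=
    trace_parallel_const V (c := fun y => ((2 : ℂ)⁻¹ * -Complex.I) • (c y - star (c y))) hpb
  have hta_real : star ta = ta := by rw [hta]; exact star_trace_of_isHermitian (isHermitian_half_add_star _)
  have htb_real : star tb = tb := by rw [htb]; exact star_trace_of_isHermitian (isHermitian_halfI_sub_star _)
  have hpa₀ := parallel_sub_smul_one V ((2 : ℂ)⁻¹ * ta) (c := fun y => (2 : ℂ)⁻¹ • (c y + star (c y))) hpa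
  have hpb₀ := parallel_sub_smul_one V ((2 : ℂ)⁻¹ * tb) (c := fun y => ((2 : ℂ)⁻¹ * -Complex.I) • (c y - star (c y))) hpb
  have h2a : star ((2 : ℂ)⁻¹ * ta) = (2 : ℂ)⁻¹ * ta := by rw [star_mul', star_inv₀, hta_real]; simp
  have h2b : star ((2 : ℂ)⁻¹ * tb) = (2 : ℂ)⁻¹ * tb := by rw [star_mul', star_inv₀, htb_real]; simp
  -- one of the two traceless Hermitian parallel parts is non-zero somewhere
  by_cases hA : ∃ y, (2 : ℂ)⁻¹ • (c y + star (c y)) - ((2 : ℂ)⁻¹ * ta) • (1 : Matrix (Fin 2) (Fin 2) ℂ) ≠ 0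
  · exact ⟨fun y => (2 : ℂ)⁻¹ • (c y + star (c y)) - ((2 : ℂ)⁻¹ * ta) • (1 : Matrix (Fin 2) (Fin 2) ℂ),
      fun y => isHermitian_sub_smul_one (isHermitian_half_add_star _) h2a, fun y => trace_sub_half_trace_smul_one _ (htra y), hpa₀, hA⟩
  by_cases hB : ∃ y, ((2 : ℂ)⁻¹ * -Complex.I) • (c y - star (c y)) - ((2 : ℂ)⁻¹ * tb) • (1 : Matrix (Fin 2) (Fin 2) ℂ) ≠ 0
  · exact ⟨fun y => ((2 : ℂ)⁻¹ * -Complex.I) • (c y - star (c y)) - ((2 : ℂ)⁻¹ * tb) • (1 : Matrix (Fin 2) (Fin 2) ℂ),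
      fun y => isHermitian_sub_smul_one (isHermitian_halfI_sub_star _) h2b, fun y => trace_sub_half_trace_smul_one _ (htrb y), hpb₀, hB⟩
  exfalso
  have hA' : ∀ y, (2 : ℂ)⁻¹ • (c y + star (c y)) - ((2 : ℂ)⁻¹ * ta) • (1 : Matrix (Fin 2) (Fin 2) ℂ) = 0 := fun y => by
    by_contra hy; exact hA ⟨y, hy⟩
  have hB' : ∀ y, ((2 : ℂ)⁻¹ * -Complex.I) • (c y - star (c y)) - ((2 : ℂ)⁻¹ * tb) • (1 : Matrix (Fin 2) (Fin 2) ℂ) = 0 := fun y => by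
    by_contra hy; exact hB ⟨y, hy⟩
  refine hns ⟨(2 : ℂ)⁻¹ * ta + Complex.I * ((2 : ℂ)⁻¹ * tb), fun y => ?_⟩
  have ha := sub_eq_zero.1 (hA' y)
  have hb := sub_eq_zero.1 (hB' y)
  rw [decomp_herm (c y), ha, hb, smul_smul, ← add_smul]

/-! ## §3 The supplier's dichotomy -/

/-- ★★★ **THE CASE SPLIT**: for every `SU(2)` configuration `V` on a torus lattice, EITHER every `V♭`-parallel section is a scalar (irreducible holonomy —
✓`hSymCentre_of_irreducible`'s hypothesis `hIrr`), OR there is a gauge transformation `g` with every bond variable of `g • V` commuting with `σ₃`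
(✓`exists_gauge_commute_sigma3_of_parallel` on the section of §2). [cite: Balaban1985BackgroundPropagators, (3.21) p.394; Balaban1985Averaging, (8) p.19] -/
theorem onlyScalar_or_exists_gauge_commute_sigma3 :
    (∀ c : Site P 0 → Matrix (Fin 2) (Fin 2) ℂ,
      (∀ e : PBond P 0, c e.src = ((unitsField (toUField V) e : (Matrix (Fin 2) (Fin 2) ℂ)ˣ) : Matrix (Fin 2) (Fin 2) ℂ) * c e.tgt *
        (((unitsField (toUField V) e)⁻¹ : (Matrix (Fin 2) (Fin 2) ℂ)ˣ) : Matrix (Fin 2) (Fin 2) ℂ)) →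
      ∃ z : ℂ, ∀ y, c y = z • (1 : Matrix (Fin 2) (Fin 2) ℂ)) ∨
    ∃ g : GaugeTransf P 0 (Matrix.specialUnitaryGroup (Fin 2) ℂ),
      ∀ e : PBond P 0, Commute ((GaugeField.gaugeAct g V e : Matrix.specialUnitaryGroup (Fin 2) ℂ) : Matrix (Fin 2) (Fin 2) ℂ) σ₃ := by
  by_cases hIrr : ∀ c : Site P 0 → Matrix (Fin 2) (Fin 2) ℂ,
      (∀ e : PBond P 0, c e.src = ((unitsField (toUField V) e : (Matrix (Fin 2) (Fin 2) ℂ)ˣ) : Matrix (Fin 2) (Fin 2) ℂ) * c e.tgt *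
        (((unitsField (toUField V) e)⁻¹ : (Matrix (Fin 2) (Fin 2) ℂ)ˣ) : Matrix (Fin 2) (Fin 2) ℂ)) →
      ∃ z : ℂ, ∀ y, c y = z • (1 : Matrix (Fin 2) (Fin 2) ℂ)
  · exact Or.inl hIrr
  · obtain ⟨h, hH, htr, hpar, h0⟩ := exists_hermitian_traceless_parallel_of_not_onlyScalar V hIrr
    exact Or.inr (exists_gauge_commute_sigma3_of_parallel V h hH htr hpar h0)

end Split

end Summit.QuantumFields.YangMills.Theorems.Prop7NestedMeanParallelLiftDiagGauge

end
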